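import Mathlib
import Summits.Ventures.PercRepro2.Defs
import Summits.Ventures.PercRepro2.Independence
import Summits.Ventures.PercRepro2.Graph
import Summits.Ventures.PercRepro2.Exploration
import Summits.Ventures.PercRepro2.Induced
import Summits.Ventures.PercRepro2.HubModel
import Summits.Ventures.PercRepro2.HubLaw

/-!
# The root-edge law: the root-bundle state is a seven-edge percolation
(blind cell PercRepro2, typer-1 g8; MINE2-HUB.md §2 (a), §5 (ii))

The seven root bundles `bundle i` (`HubLaw.lean`) are the edge sets `bundleEdges ends μ i` of the
edges joining the two marks of the bundle.  For an injective marking they are pairwise disjoint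
(`disjoint_bundleEdges`), the state `W_i` of bundle `i` is `true` iff some edge of the bundle is
open (`openAdj_bundle_iff`), so it is determined by the bundle (`dependsOn_rootState_apply`) and
`P(W_i = false) = ∏_{e ∈ bundle i} (1 - p_e)` (`prob_allClosed`).  Independence over the seven
disjoint bundles gives the **root-edge law**

`P(W = w) = ∏_i q_i^{w_i} (1 - q_i)^{1 - w_i}`,  `q_i = 1 - ∏_{e ∈ bundle i} (1 - p_e)`

(`prob_rootState_eq`), i.e. `P(W = w) = weight q w` (`prob_rootState_eq_weight`): the root-bundle
state is itself Bernoulli bond percolation on the seven bundles with weights `q = bundleProb`.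
Hence the hub law of `HubLaw.lean` reads (`prob_hubEvent_eq`)

`P(Φ(W, Π)) = Σ_π P_q(Φ(·, π)) · m_π`,  `m_π = P(Π = π)`,

a polynomial in the bundle weights `q` whose coefficients are the inner masses `m_π`
(MINE2-HUB.md §2 (a): `L(p, m)` with `p ↦ q`).
-/

namespace Summit.Ventures.PercRepro2.Hub

/-- The unordered pair of marks of a root bundle. -/
def bundlePair (i : Fin 7) : Sym2 Mark := s((bundle i).1, (bundle i).2)

/-- The seven root bundles are distinct unordered pairs of marks. -/
lemma bundlePair_injective : Function.Injective bundlePair := by decide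

variable {V : Type*} {E : Type*}

section State

variable (ends : E → Sym2 V) (μ : Mark → V)

open Classical in
/-- `W_i = true` iff the marks of bundle `i` are openly adjacent. -/
lemma rootState_eq_true_iff (ω : Config E) (i : Fin 7) :
    rootState ends μ ω i = true ↔ OpenAdj ends ω (μ (bundle i).1) (μ (bundle i).2) := by
  unfold rootState
  exact decide_eq_true_iff

/-- `W_i = false` iff the marks of bundle `i` are not openly adjacent. -/
lemma rootState_eq_false_iff (ω : Config E) (i : Fin 7) :
    rootState ends μ ω i = false ↔ ¬ OpenAdj ends ω (μ (bundle i).1) (μ (bundle i).2) := by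
  rw [← rootState_eq_true_iff, Bool.not_eq_true]

/-- The event `{W = w on s}`: the bundles of the index set `s` are in the states prescribed by
`w`. -/
def stateOn (s : Finset (Fin 7)) (w : Fin 7 → Bool) : Set (Config E) :=
  {ω | ∀ i ∈ s, rootState ends μ ω i = w i}

/-- `{W = w on insert i s} = {W_i = w_i} ∩ {W = w on s}`. -/
lemma stateOn_insert (s : Finset (Fin 7)) (w : Fin 7 → Bool) (i : Fin 7) :
    stateOn ends μ (insert i s) w =
      {ω | rootState ends μ ω i = w i} ∩ stateOn ends μ s w := by
  ext ω
  simp only [stateOn, Set.mem_setOf_eq, Set.mem_inter_iff, Finset.mem_insert, forall_eq_or_imp]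

/-- `{W = w on ∅}` is everything. -/
lemma stateOn_empty (w : Fin 7 → Bool) : stateOn ends μ (∅ : Finset (Fin 7)) w = Set.univ := by
  ext ω
  simp [stateOn]

/-- `{W = w on univ} = {W = w}`. -/
lemma stateOn_univ (w : Fin 7 → Bool) :
    stateOn ends μ Finset.univ w = {ω | rootState ends μ ω = w} := by
  ext ω
  simp only [stateOn, Set.mem_setOf_eq, Finset.mem_univ, true_implies]
  exact funext_iff.symm

end State

section Edges

variable [Fintype E] [DecidableEq V] (ends : E → Sym2 V) (μ : Mark → V)

/-- The edges of the `i`-th root bundle: the edges joining its two marks. -/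
def bundleEdges (i : Fin 7) : Finset E :=
  Finset.univ.filter fun e => ends e = s(μ (bundle i).1, μ (bundle i).2)

/-- Membership in a root bundle. -/
lemma mem_bundleEdges {i : Fin 7} {e : E} :
    e ∈ bundleEdges ends μ i ↔ ends e = s(μ (bundle i).1, μ (bundle i).2) := by
  simp [bundleEdges]

/-- Distinct root bundles have disjoint edge sets (injective marking). -/
lemma disjoint_bundleEdges (hinj : Function.Injective μ) {i j : Fin 7} (hij : i ≠ j) :
    Disjoint (↑(bundleEdges ends μ i) : Set E) ↑(bundleEdges ends μ j) := by
  rw [Set.disjoint_left]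
  intro e hi hj
  rw [Finset.mem_coe, mem_bundleEdges] at hi hj
  apply hij
  apply bundlePair_injective
  apply Sym2.map.injective hinj
  rw [bundlePair, bundlePair, Sym2.map_mk, Sym2.map_mk, ← hi, ← hj]

/-- A root bundle is disjoint from the union of the bundles of an index set not containing it. -/
lemma disjoint_bundleEdges_biUnion (hinj : Function.Injective μ) {s : Finset (Fin 7)} {i : Fin 7}
    (hi : i ∉ s) :
    Disjoint (↑(bundleEdges ends μ i) : Set E) (⋃ j ∈ s, (↑(bundleEdges ends μ j) : Set E)) := by
  rw [Set.disjoint_left]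
  intro e he hu
  obtain ⟨j, hj, hej⟩ := Set.mem_iUnion₂.1 hu
  exact Set.disjoint_left.1 (disjoint_bundleEdges ends μ hinj fun h => hi (by rw [h]; exact hj)) he hej

/-- The marks of bundle `i` are openly adjacent iff some edge of the bundle is open. -/
lemma openAdj_bundle_iff (ω : Config E) (i : Fin 7) :
    OpenAdj ends ω (μ (bundle i).1) (μ (bundle i).2) ↔
      ∃ e ∈ bundleEdges ends μ i, ω e = true := by
  constructor
  · rintro ⟨e, he, hends⟩
    exact ⟨e, (mem_bundleEdges ends μ).2 hends, he⟩
  · rintro ⟨e, he, hω⟩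
    exact ⟨e, hω, (mem_bundleEdges ends μ).1 he⟩

/-- The state of bundle `i` is `false` iff all edges of the bundle are closed. -/
lemma rootState_eq_false_iff_allClosed (ω : Config E) (i : Fin 7) :
    rootState ends μ ω i = false ↔ ω ∈ allClosed (bundleEdges ends μ i) := by
  rw [rootState_eq_false_iff, openAdj_bundle_iff, mem_allClosed]
  simp only [not_exists, not_and, Bool.not_eq_true]

/-- The event `{W_i = false}` is the event that bundle `i` is closed. -/
lemma setOf_rootState_eq_false (i : Fin 7) :
    {ω : Config E | rootState ends μ ω i = false} = allClosed (bundleEdges ends μ i) := by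
  ext ω
  exact rootState_eq_false_iff_allClosed ends μ ω i

/-- The event `{W_i = true}` is the complement of the event that bundle `i` is closed. -/
lemma setOf_rootState_eq_true (i : Fin 7) :
    {ω : Config E | rootState ends μ ω i = true} = (allClosed (bundleEdges ends μ i))ᶜ := by
  ext ω
  rw [Set.mem_setOf_eq, Set.mem_compl_iff, ← rootState_eq_false_iff_allClosed ends μ ω i,
    Bool.not_eq_false]

/-- The state of bundle `i` is determined by the edges of the bundle. -/
lemma dependsOn_rootState_apply (i : Fin 7) (b : Bool) :
    DependsOn (· ∈ {ω : Config E | rootState ends μ ω i = b}) ↑(bundleEdges ends μ i) := by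
  intro ω ω' h
  show (rootState ends μ ω i = b) = (rootState ends μ ω' i = b)
  have key : rootState ends μ ω i = rootState ends μ ω' i := by
    rw [Bool.eq_iff_iff, rootState_eq_true_iff, rootState_eq_true_iff, openAdj_bundle_iff,
      openAdj_bundle_iff]
    constructor
    · rintro ⟨e, he, hω⟩
      exact ⟨e, he, by rw [← h e he]; exact hω⟩
    · rintro ⟨e, he, hω⟩
      exact ⟨e, he, by rw [h e he]; exact hω⟩
  rw [key]

/-- `{W = w on s}` is determined by the edges of the bundles of `s`. -/
lemma dependsOn_stateOn (s : Finset (Fin 7)) (w : Fin 7 → Bool) :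
    DependsOn (· ∈ stateOn ends μ s w) (⋃ i ∈ s, (↑(bundleEdges ends μ i) : Set E)) := by
  intro ω ω' h
  show (∀ i ∈ s, rootState ends μ ω i = w i) = (∀ i ∈ s, rootState ends μ ω' i = w i)
  refine propext (forall₂_congr fun i hi => ?_)
  exact dependsOn_mem_iff (dependsOn_rootState_apply ends μ i (w i)) fun e he =>
    h e (Set.mem_iUnion₂.2 ⟨i, hi, he⟩)

end Edges

section Law

variable [Fintype E] [DecidableEq E] [DecidableEq V] {R : Type*} [CommRing R]
variable (ends : E → Sym2 V) (μ : Mark → V)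

/-- The bundle weight `q_i = 1 - ∏_{e ∈ bundle i} (1 - p_e)`: the probability that bundle `i` has
an open edge. -/
def bundleProb (p : E → R) (i : Fin 7) : R := 1 - ∏ e ∈ bundleEdges ends μ i, (1 - p e)

/-- `P(W_i = b) = q_i` if `b`, `1 - q_i` otherwise. -/
theorem prob_rootState_apply (p : E → R) (i : Fin 7) (b : Bool) :
    prob p {ω | rootState ends μ ω i = b} = edgeFactor (bundleProb ends μ p i) b := by
  cases b
  · rw [setOf_rootState_eq_false, prob_allClosed, edgeFactor_false, bundleProb]
    ring
  · rw [setOf_rootState_eq_true, prob_compl, prob_allClosed, edgeFactor_true, bundleProb]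

/-- The law of the states of the bundles of an index set: a product over the set. -/
theorem prob_stateOn (hinj : Function.Injective μ) (p : E → R) (w : Fin 7 → Bool)
    (s : Finset (Fin 7)) :
    prob p (stateOn ends μ s w) = ∏ i ∈ s, edgeFactor (bundleProb ends μ p i) (w i) := by
  classical
  induction s using Finset.induction_on with
  | empty => rw [stateOn_empty, prob_univ, Finset.prod_empty]
  | insert i s hi ih =>
    rw [stateOn_insert, Finset.prod_insert hi, ← ih, ← prob_rootState_apply ends μ p i (w i)]
    exact prob_inter_eq_mul_of_dependsOn p (disjoint_bundleEdges_biUnion ends μ hinj hi)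
      (dependsOn_rootState_apply ends μ i (w i)) (dependsOn_stateOn ends μ s w)

/-- **The root-edge law**: `P(W = w) = ∏_i q_i^{w_i} (1 - q_i)^{1 - w_i}`. -/
theorem prob_rootState_eq (hinj : Function.Injective μ) (p : E → R) (w : Fin 7 → Bool) :
    prob p {ω | rootState ends μ ω = w} = ∏ i, edgeFactor (bundleProb ends μ p i) (w i) := by
  rw [← stateOn_univ, prob_stateOn ends μ hinj p w Finset.univ]

/-- **The root-bundle state is a seven-edge percolation**: `P(W = w) = weight q w` with the
bundle weights `q = bundleProb`. -/
theorem prob_rootState_eq_weight (hinj : Function.Injective μ) (p : E → R) (w : Fin 7 → Bool) :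
    prob p {ω | rootState ends μ ω = w} = weight (bundleProb ends μ p) w := by
  rw [prob_rootState_eq ends μ hinj p w, weight_apply]

/-- **The hub law in bundle weights**: for an event determined by the state pair,
`P(Φ(W, Π)) = Σ_π P_q(Φ(·, π)) · P(Π = π)`, where `P_q` is percolation on the seven bundles
with weights `q = bundleProb` — a polynomial in `q` with the inner masses as coefficients. -/
theorem prob_hubEvent_eq (hinj : Function.Injective μ) (p : E → R)
    (Φ : (Fin 7 → Bool) → (Fin 3 → Bool) → Prop) [∀ w π, Decidable (Φ w π)] :
    prob p {ω | Φ (rootState ends μ ω) (innerPat ends μ ω)} =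
      ∑ π, prob (bundleProb ends μ p) {w | Φ w π} * prob p {ω | innerPat ends μ ω = π} := by
  classical
  rw [prob_hubEvent, Finset.sum_comm]
  refine Finset.sum_congr rfl fun π _ => ?_
  have hq : prob (bundleProb ends μ p) {w | Φ w π} =
      ∑ w, if Φ w π then weight (bundleProb ends μ p) w else 0 := by
    unfold prob
    refine Finset.sum_congr rfl fun w _ => ?_
    simp only [Set.indicator_apply, Set.mem_setOf_eq]
  rw [hq, Finset.sum_mul]
  refine Finset.sum_congr rfl fun w _ => ?_
  rw [prob_rootState_eq_weight ends μ hinj p w]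
  split_ifs <;> simp

end Law

end Summit.Ventures.PercRepro2.Hub
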